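import Summits.CriticalPhenomena.PercolationContinuityZ3.Theorems.Transplant.SkelSeedSlabDeepAvoid
import Summits.CriticalPhenomena.PercolationContinuityZ3.Theorems.Transplant.SkelStepIVInputs
import Summits.CriticalPhenomena.PercolationContinuityZ3.Theorems.Transplant.KNLevelsStepIV
import Summits.CriticalPhenomena.PercolationContinuityZ3.Theorems.Transplant.SkelCubeAt
import Summits.CriticalPhenomena.PercolationContinuityZ3.Theorems.Transplant.BoxProdZ2KitStepIV
import HarnessLib

/-!
# L5.9 of the general node (`HOME/SHEAR-SCOPE.md` §3.9): the KIT CLAUSE of a window level over a planar skeleton (exploration graph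
# `winGraph G w₀ R`) — generic twin of `BoxProdZ2Kits.kitClause`, from the deep seed slab (L5.5b v3), the cube behind it (p3-g4's
# `SkelCubeAt`), the Step-IV glue of L5.7 (`Skel.exists_stepIV_inputs_of_le` + `KNLevels.stepIV_in`, inlined instance-polymorphically) and the edge-contact remedy; the cube geometry enters as ROOM hypotheses

builds on p205010 (kernel theorem, internal audit signed; external expert review pending) — nothing in this file uses p205010.
Lane `prim-bschramm`, seat `prim-bschramm-p1` (gen 7; claim L5.9, rulings p3-g4 2026-08-20 19:11Z (2) / 20:38Z (2)); helper file
(`--supports stmt-CriticalPhenomena-4575 --as helper`); namespace `Transplant.SkelI`, `[DecidableEq V]` binder.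
* §1 the pinning set **`pinSet`** `= Win(Icc (Lo + 2ℓs + 2) (Hi − 2ℓs − 2)) R ∪ Yfar` (shell window ∪ far inner neighbours): `pinSet_subset_winLevel`,
  `pinSet_spec` (the `hT` shape of `slabSeedDeep_notMem_wireSet`);
* §2 **`kitClause`** — the per-level clause `hkits` of `Skel.WinStepData.kitsAt_tstep` / `KNLevels.TStep.KitsAt`: `∃ σ S, SHyp L j σ ∧ σ.N ≤ N ∧
  (1 − q^{sB})^k ≤ δ ∧ S ⊆ B⟨j⟩ ∧ S ⊆ D ∧ seeds off wireSet S ∧ faces ⊆ S ∧ hIV`, with `σ := kitSData … (slabGeomDeep …)`, `S := pinSet`, from: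
  the Step-I input family at `q` (margin `δ²`), the slab constants (`kitOK_slabDeep`), the near-face conditions `NearFaceOKDeep` for a face map `Unear` that IS the cube face
  `Skel.cubeFace Φ hC (deepCtr x) i₀ σ ℓs M` at near contacts (p3-g4's `SkelI.cubeU`), the ROOM facts (faces in the shell box, cubes in the shell window and with their face on
  the window-graph inner boundary), and the per-contact dichotomy `hcon` (a face vertex in `T`, or — near contact — the ROUTE HYPOTHESIS of p3-g4's
  `Skel.kit_hIV_of_route`: for every representative `t`, a linked target piece off the cube; straight routes via `Skel.hcon_of_straight`).
[cite: KozmaNitzan2024, §4 Lemma 10, Steps III–V (pp. 19–22)] [cite: GrimmettPercolation1999, §7.2]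
-/

noncomputable section

open MeasureTheory
open scoped Classical

namespace Summit.CriticalPhenomena.PercolationContinuityZ3.Theorems

namespace Transplant

namespace SkelI

open Literature.Probability.Percolation Literature.Probability.LatticeModels SimpleGraph KNLevels KozmaNitzan
open Literature.Probability.Percolation.GM (HOct)
open Literature.Barriers.CriticalPhenomena (graphBall graphBall_finite mem_graphBall_self graphBall_mono)
open Skel (winGraph winGraph_adj winGraph_le winLevel mem_winLevel_iff winLData winLData_X inNbr KitGeom fatSeq macroPiece fatRadius
  cubeCtr cubeFace)

variable {V : Type} [DecidableEq V] {G : SimpleGraph V} [G.LocallyFinite] (Φ : PlanarSkeletonConc G)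

/-! ## §1 The pinning set: shell window ∪ far inner neighbours -/

/-- **The pinning set of the window level `j`**: the shell window `Win(Icc (Lo + 2ℓs + 2) (Hi − 2ℓs − 2)) R` together with the inner
neighbours of the FAR candidate contacts (`y ∉ B_G(w₀, R − r₀)`). [cite: KozmaNitzan2024, §4 p. 21 ("Q ⊆ S")] -/
def pinSet (w₀ : V) (R : ℕ) (lo hi : Site 2) (j ℓs r₀ : ℕ) : Finset V :=
  Φ.Win w₀ (Finset.Icc ((lo - (j : Site 2)) + ((2 * ℓs + 2 : ℕ) : Site 2)) ((hi + (j : Site 2)) - ((2 * ℓs + 2 : ℕ) : Site 2))) R ∪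
    ((outerBoundary (winGraph G w₀ R) (winLevel Φ w₀ R lo hi j)).filter fun x => inNbr Φ w₀ R (Finset.Icc (lo - (j : Site 2)) (hi + (j : Site 2))) x ∉ graphBall G w₀ (R - r₀)).image
      fun x => inNbr Φ w₀ R (Finset.Icc (lo - (j : Site 2)) (hi + (j : Site 2))) x

/-- The pinning set lies in the level `B⟨j⟩`. [folklore] -/
theorem pinSet_subset_winLevel (w₀ : V) (R : ℕ) (lo hi : Site 2) (j ℓs r₀ : ℕ) :
    pinSet Φ w₀ R lo hi j ℓs r₀ ⊆ winLevel Φ w₀ R lo hi j := by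
  intro v hv
  rw [pinSet, Finset.mem_union] at hv
  rw [mem_winLevel_iff]
  rcases hv with hv | hv
  · rw [PlanarSkeletonConc.mem_Win] at hv
    refine ⟨hv.1, ?_⟩
    have h := hv.2
    rw [Finset.mem_Icc, Pi.le_def, Pi.le_def] at h ⊢
    refine ⟨fun i => ?_, fun i => ?_⟩
    · have h1 := h.1 i; simp only [Pi.add_apply, Pi.natCast_apply] at h1; push_cast at h1; linarith
    · have h2 := h.2 i; simp only [Pi.sub_apply, Pi.natCast_apply] at h2; push_cast at h2; linarith
  · rw [Finset.mem_image] at hv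
    obtain ⟨x, hx, rfl⟩ := hv
    rw [Finset.mem_filter] at hx
    have h := inNbr_spec Φ (P := Finset.Icc (lo - (j : Site 2)) (hi + (j : Site 2))) hx.1
    exact ⟨h.2.1, h.2.2⟩

/-- Members of the pinning set are shell vertices or far boundary-layer vertices (the `hT` shape of `slabSeedDeep_notMem_wireSet`). [folklore] -/
theorem pinSet_spec (w₀ : V) (R : ℕ) (lo hi : Site 2) (j ℓs r₀ : ℕ) :
    ∀ v ∈ (↑(pinSet Φ w₀ R lo hi j ℓs r₀) : Set V), Φ.φ v ∈ Finset.Icc (lo - (j : Site 2)) (hi + (j : Site 2)) ∧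
      (Φ.φ v ∈ Finset.Icc ((lo - (j : Site 2)) + ((2 * ℓs + 2 : ℕ) : Site 2)) ((hi + (j : Site 2)) - ((2 * ℓs + 2 : ℕ) : Site 2)) ∨
        (Φ.φ v ∉ Finset.Icc ((lo - (j : Site 2)) + 1) ((hi + (j : Site 2)) - 1) ∧ v ∉ graphBall G w₀ (R - r₀))) := by
  intro v hv
  rw [Finset.mem_coe] at hv
  refine ⟨((mem_winLevel_iff Φ).1 (pinSet_subset_winLevel Φ w₀ R lo hi j ℓs r₀ hv)).2, ?_⟩
  rw [pinSet, Finset.mem_union] at hv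
  rcases hv with hv | hv
  · exact Or.inl (Φ.mem_Win.1 hv).2
  · right
    rw [Finset.mem_image] at hv
    obtain ⟨x, hx, rfl⟩ := hv
    rw [Finset.mem_filter] at hx
    refine ⟨fun hin => ?_, hx.2⟩
    obtain ⟨i, hface⟩ := exists_coord_eq_of_contact Φ (Lo := (lo - (j : Site 2))) (Hi := (hi + (j : Site 2))) hx.1
    rw [Finset.mem_Icc, Pi.le_def, Pi.le_def] at hin
    have h1 := hin.1 i; have h2 := hin.2 i
    rcases hface with hf | hf <;> rw [hf] at h1 h2 <;>
      simp only [Pi.add_apply, Pi.sub_apply, Pi.natCast_apply, Pi.one_apply] at h1 h2 <;> omega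

/-! ## §2 The kit clause -/

/-- **The kit clause of `KitsAt` / `TargetProperty` for a window level over a planar skeleton** (exploration graph `winGraph G w₀ R`).
[cite: KozmaNitzan2024, §4 Lemma 10, Steps III–IV (pp. 19–21)] -/
theorem kitClause [Countable V] {p : unitInterval} (hC : Φ.toPlanarSkeleton.CylSubcritical p) (msel : V → ℕ) {Ssc : Finset ℕ}
    {q : unitInterval} {δ : ℝ} (hδ : 0 < δ)
    (hin : ∀ i ∈ Skel.inputIndex Φ Ssc, 1 - δ ^ 2 < (bondPercolation G q).real (Skel.inputEvent Φ hC msel i))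
    {M : ℕ} (hM : M ∈ Ssc) (hmsel : ∀ t ∈ Φ.types, msel t ≤ M)
    -- the window level and the slab constants
    {w₀ : V} {R : ℕ} {lo hi : Site 2} {j ℓs R' r₀ rs : ℕ} (hℓs : 1 ≤ ℓs)
    (hwide : ∀ i, (lo - (j : Site 2)) i + 2 * tanOff ℓs M ≤ (hi + (j : Site 2)) i)
    (hR' : ∀ c : V, graphBall G c (ℓs + 2 + 2 * tanOff ℓs M) ∩ Φ.toPlanarSkeleton.cyl c ℓs ⊆ Φ.cylBall c ℓs R')
    (hr₀ : ℓs + 1 + tanOff ℓs M + R' ≤ r₀) (hR : r₀ ≤ R) (hrs : ℓs + 2 + tanOff ℓs M + R' ≤ rs)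
    {Unear : V → Finset V} {cU : ℕ} (hU : NearFaceOKDeep Φ w₀ R lo hi j ℓs M R' r₀ rs cU Unear)
    (hUdef : ∀ x ∈ outerBoundary (winGraph G w₀ R) (winLevel Φ w₀ R lo hi j),
      inNbr Φ w₀ R (Finset.Icc (lo - (j : Site 2)) (hi + (j : Site 2))) x ∈ graphBall G w₀ (R - r₀) →
      Unear x = cubeFace Φ hC (deepCtr Φ w₀ R (lo - (j : Site 2)) (hi + (j : Site 2)) ℓs M x) (exitDir Φ w₀ R (lo - (j : Site 2)) (hi + (j : Site 2)) x).1 (exitDir Φ w₀ R (lo - (j : Site 2)) (hi + (j : Site 2)) x).2 ℓs M)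
    -- ROOM: faces in the shell box; cubes of near contacts in the shell window, faces on their window-graph inner boundary
    (hUsh : ∀ x ∈ outerBoundary (winGraph G w₀ R) (winLevel Φ w₀ R lo hi j),
      ∀ u ∈ Unear x,
        Φ.φ u ∈ Finset.Icc ((lo - (j : Site 2)) + ((2 * ℓs + 2 : ℕ) : Site 2)) ((hi + (j : Site 2)) - ((2 * ℓs + 2 : ℕ) : Site 2)))
    (hcube : ∀ x ∈ outerBoundary (winGraph G w₀ R) (winLevel Φ w₀ R lo hi j), inNbr Φ w₀ R (Finset.Icc (lo - (j : Site 2)) (hi + (j : Site 2))) x ∈ graphBall G w₀ (R - r₀) →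
      fatSeq Φ hC (cubeCtr Φ (deepCtr Φ w₀ R (lo - (j : Site 2)) (hi + (j : Site 2)) ℓs M x) (exitDir Φ w₀ R (lo - (j : Site 2)) (hi + (j : Site 2)) x).1 (exitDir Φ w₀ R (lo - (j : Site 2)) (hi + (j : Site 2)) x).2 ℓs M) M ⊆
        Φ.Win w₀ (Finset.Icc ((lo - (j : Site 2)) + ((2 * ℓs + 2 : ℕ) : Site 2)) ((hi + (j : Site 2)) - ((2 * ℓs + 2 : ℕ) : Site 2))) R ∧
      Unear x ⊆ innerBoundary (winGraph G w₀ R)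
          (fatSeq Φ hC (cubeCtr Φ (deepCtr Φ w₀ R (lo - (j : Site 2)) (hi + (j : Site 2)) ℓs M x) (exitDir Φ w₀ R (lo - (j : Site 2)) (hi + (j : Site 2)) x).1 (exitDir Φ w₀ R (lo - (j : Site 2)) (hi + (j : Site 2)) x).2 ℓs M) M))
    -- the level's source/support, the weighting, the region and the target
    (k : ℕ) (o : V) (Sfin : Finset V) {Wt : Sym2 V → unitInterval} {D T : Finset V}
    (hWD : IsSubbox (winGraph G w₀ R) Wt q D) (hXD : winLevel Φ w₀ R lo hi j ⊆ D) {N : ℕ}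
    (hN : k * (Φ.Δ + 1) ^ (2 * rs) ≤ N)
    (hk : (1 - (q : ℝ) ^ (1 + Φ.Δ * ((Φ.Δ + 1) ^ R' + (tanOff ℓs M + 2)) +
      ((Φ.Δ + 1) ^ R' + (tanOff ℓs M + 2)) * cU)) ^ k ≤ δ)
    -- the per-contact dichotomy: a face vertex in the target, or (near contact) the ROUTE HYPOTHESIS of `Skel.kit_hIV_of_route`
    -- (for every representative `t` carrying the inputs at the cube centre: a linked target piece `Ft ⊆ T` inside `Qt ⊆ D` off the cube)
    (hcon : ∀ x ∈ outerBoundary (winGraph G w₀ R) (winLevel Φ w₀ R lo hi j),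
      (∃ u ∈ (slabGeomDeep Φ w₀ R lo hi j ℓs M R' r₀ Unear).U x, u ∈ T) ∨
      (inNbr Φ w₀ R (Finset.Icc (lo - (j : Site 2)) (hi + (j : Site 2))) x ∈ graphBall G w₀ (R - r₀) ∧ ∀ t ∈ Φ.types,
        (∀ M' ∈ Ssc, 1 - δ ^ 2 < (bondPercolation G q).real (UniqZone.zone G (fatSeq Φ hC (cubeCtr Φ (deepCtr Φ w₀ R (lo - (j : Site 2)) (hi + (j : Site 2)) ℓs M x) (exitDir Φ w₀ R (lo - (j : Site 2)) (hi + (j : Site 2)) x).1 (exitDir Φ w₀ R (lo - (j : Site 2)) (hi + (j : Site 2)) x).2 ℓs M)) (msel t) M') ∧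
          ∀ g' : HOct 2, 1 - δ ^ 2 < (bondPercolation G q).real
            (linkIn (↑(fatSeq Φ hC (cubeCtr Φ (deepCtr Φ w₀ R (lo - (j : Site 2)) (hi + (j : Site 2)) ℓs M x) (exitDir Φ w₀ R (lo - (j : Site 2)) (hi + (j : Site 2)) x).1 (exitDir Φ w₀ R (lo - (j : Site 2)) (hi + (j : Site 2)) x).2 ℓs M) M')) (fatSeq Φ hC (cubeCtr Φ (deepCtr Φ w₀ R (lo - (j : Site 2)) (hi + (j : Site 2)) ℓs M x) (exitDir Φ w₀ R (lo - (j : Site 2)) (hi + (j : Site 2)) x).1 (exitDir Φ w₀ R (lo - (j : Site 2)) (hi + (j : Site 2)) x).2 ℓs M) (msel t)) (macroPiece Φ (cubeCtr Φ (deepCtr Φ w₀ R (lo - (j : Site 2)) (hi + (j : Site 2)) ℓs M x) (exitDir Φ w₀ R (lo - (j : Site 2)) (hi + (j : Site 2)) x).1 (exitDir Φ w₀ R (lo - (j : Site 2)) (hi + (j : Site 2)) x).2 ℓs M) M' (fatRadius Φ hC M') g'))) →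
        ∃ Qt Ft : Finset V, Ft ⊆ T ∧ Qt ⊆ D ∧ (∀ u ∈ Qt, ∀ v ∈ Qt, G.Adj u v → (winGraph G w₀ R).Adj u v) ∧
          Disjoint Ft (fatSeq Φ hC (cubeCtr Φ (deepCtr Φ w₀ R (lo - (j : Site 2)) (hi + (j : Site 2)) ℓs M x) (exitDir Φ w₀ R (lo - (j : Site 2)) (hi + (j : Site 2)) x).1 (exitDir Φ w₀ R (lo - (j : Site 2)) (hi + (j : Site 2)) x).2 ℓs M) M) ∧
          1 - δ ^ 2 < (prodBernoulli Wt).real (linkIn (↑Qt) (fatSeq Φ hC (cubeCtr Φ (deepCtr Φ w₀ R (lo - (j : Site 2)) (hi + (j : Site 2)) ℓs M x) (exitDir Φ w₀ R (lo - (j : Site 2)) (hi + (j : Site 2)) x).1 (exitDir Φ w₀ R (lo - (j : Site 2)) (hi + (j : Site 2)) x).2 ℓs M) (msel t)) Ft))) :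
    ∃ (σ : SData V) (S : Finset V), SHyp (winLData Φ w₀ R lo hi o Sfin) j σ ∧ σ.N ≤ N ∧
      (1 - (q : ℝ) ^ σ.sB) ^ σ.k ≤ δ ∧ S ⊆ (winLData Φ w₀ R lo hi o Sfin).X j ∧ S ⊆ D ∧
      (∀ x ∈ σ.K, ∀ e ∈ σ.seed x, e ∉ wireSet (↑S : Set V)) ∧ (∀ x ∈ σ.K, σ.face x ⊆ S) ∧
      (∀ x ∈ σ.K, 1 - 3 * δ ≤ (prodBernoulli Wt).real {ω | ∃ u ∈ σ.face x,
        1 - δ < (prodBernoulli (pinW Wt (wireSet (↑S : Set V)) ω)).real (⋃ t ∈ T, openConnIn (↑D : Set V) u t)}) := by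
  set κ := slabGeomDeep Φ w₀ R lo hi j ℓs M R' r₀ Unear with hκ
  set Spin := pinSet Φ w₀ R lo hi j ℓs r₀ with hSpin
  have hOK := kitOK_slabDeep Φ hwide hR' hr₀ hR hrs hU
  have hSX : Spin ⊆ winLevel Φ w₀ R lo hi j := pinSet_subset_winLevel Φ w₀ R lo hi j ℓs r₀
  have hSD : Spin ⊆ D := hSX.trans hXD
  -- faces lie in the pinning set
  have hface : ∀ x ∈ outerBoundary (winGraph G w₀ R) (winLevel Φ w₀ R lo hi j), κ.U x ⊆ Spin := by
    intro x hx u hu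
    simp only [hκ, slabGeomDeep] at hu
    rw [hSpin, pinSet, Finset.mem_union]
    split_ifs at hu with hnear
    · left
      rw [Φ.mem_Win]
      exact ⟨((mem_winLevel_iff Φ).1 (hU.sub x hx hnear hu)).1, hUsh x hx u hu⟩
    · right
      rw [Finset.mem_singleton] at hu
      rw [hu, Finset.mem_image]
      exact ⟨x, Finset.mem_filter.2 ⟨hx, hnear⟩, rfl⟩
  refine ⟨kitSData Φ w₀ R lo hi j κ rs ((Φ.Δ + 1) ^ R' + (tanOff ℓs M + 2)) cU k, Spin,
    shyp_kit hOK o Sfin k, hN, hk, by rw [winLData_X]; exact hSX, hSD, fun x hx e he => ?_, fun x hx => ?_, fun x hx => ?_⟩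
  · -- seeds avoid the pairs of the pinning set
    rw [kitSData_K] at hx
    rw [kitSData_seed] at he
    exact slabSeedDeep_notMem_wireSet Φ hℓs hwide hUsh hx (pinSet_spec Φ w₀ R lo hi j ℓs r₀) he
  · rw [kitSData_K] at hx; rw [kitSData_face]; exact hface x hx
  · -- Step IV: edge contacts by the face-in-target shortcut, near contacts by `kit_hIV_of_le`
    rw [kitSData_K] at hx
    rw [kitSData_face]
    rcases hcon x hx with ⟨u, hu, huT⟩ | ⟨hnear, hroute⟩
    · exact hIV_of_mem_face hδ hu huT (hSD (hface x hx hu))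
    · have hUx : κ.U x = Unear x := by simp only [hκ, slabGeomDeep, if_pos hnear]
      rw [hUx]
      obtain ⟨hcS, hcib⟩ := hcube x hx hnear
      have hcS' : fatSeq Φ hC (cubeCtr Φ (deepCtr Φ w₀ R (lo - (j : Site 2)) (hi + (j : Site 2)) ℓs M x) (exitDir Φ w₀ R (lo - (j : Site 2)) (hi + (j : Site 2)) x).1 (exitDir Φ w₀ R (lo - (j : Site 2)) (hi + (j : Site 2)) x).2 ℓs M) M ⊆ Spin := fun v hv => by rw [hSpin, pinSet]; exact Finset.mem_union_left _ (hcS hv)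
      have hcR : ∀ v ∈ fatSeq Φ hC (cubeCtr Φ (deepCtr Φ w₀ R (lo - (j : Site 2)) (hi + (j : Site 2)) ℓs M x) (exitDir Φ w₀ R (lo - (j : Site 2)) (hi + (j : Site 2)) x).1 (exitDir Φ w₀ R (lo - (j : Site 2)) (hi + (j : Site 2)) x).2 ℓs M) M, v ∈ graphBall G w₀ R := fun v hv => (Φ.mem_Win.1 (hcS hv)).1
      have hUg : Unear x = macroPiece Φ (cubeCtr Φ (deepCtr Φ w₀ R (lo - (j : Site 2)) (hi + (j : Site 2)) ℓs M x) (exitDir Φ w₀ R (lo - (j : Site 2)) (hi + (j : Site 2)) x).1 (exitDir Φ w₀ R (lo - (j : Site 2)) (hi + (j : Site 2)) x).2 ℓs M) M (fatRadius Φ hC M) (Skel.faceElt (exitDir Φ w₀ R (lo - (j : Site 2)) (hi + (j : Site 2)) x).1 (exitDir Φ w₀ R (lo - (j : Site 2)) (hi + (j : Site 2)) x).2) := by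
        rw [hUdef x hx hnear, Skel.cubeFace]
      -- Step IV (the body of `Skel.kit_hIV_of_route`, instance-polymorphically): p3-g4's input package + `KNLevels.stepIV_in`
      obtain ⟨t, ht, hall⟩ := Skel.exists_inputs_at_center_all Φ hC msel hin (cubeCtr Φ (deepCtr Φ w₀ R (lo - (j : Site 2)) (hi + (j : Site 2)) ℓs M x) (exitDir Φ w₀ R (lo - (j : Site 2)) (hi + (j : Site 2)) x).1 (exitDir Φ w₀ R (lo - (j : Site 2)) (hi + (j : Site 2)) x).2 ℓs M)
      obtain ⟨h1, h2⟩ := Skel.inputs_at_center_of_le Φ hC (winGraph_le G w₀ R) hWD (hcS'.trans hSD)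
        (Skel.adj_winGraph_of_subset_graphBall hcR) (hall M hM).1 (hall M hM).2
      obtain ⟨Qt, Ft, hFT, hQD, -, hdisj, h3⟩ := hroute t ht hall
      have hkn := Skel.fatSeq_monotone Φ hC (cubeCtr Φ (deepCtr Φ w₀ R (lo - (j : Site 2)) (hi + (j : Site 2)) ℓs M x) (exitDir Φ w₀ R (lo - (j : Site 2)) (hi + (j : Site 2)) x).1 (exitDir Φ w₀ R (lo - (j : Site 2)) (hi + (j : Site 2)) x).2 ℓs M) (hmsel t ht)
      have h2' := h2 (Skel.faceElt (exitDir Φ w₀ R (lo - (j : Site 2)) (hi + (j : Site 2)) x).1 (exitDir Φ w₀ R (lo - (j : Site 2)) (hi + (j : Site 2)) x).2)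
      rw [← hUg] at h2'
      exact stepIV_in (G := winGraph G w₀ R) (S := Spin) hWD hFT hQD _ hkn hcS' hcib hdisj hδ (Rg := (↑D : Set V))
        (Finset.coe_subset.2 (hcS'.trans hSD)) (Finset.coe_subset.2 hQD) h1 h2' h3

end SkelI

end Transplant

end Summit.CriticalPhenomena.PercolationContinuityZ3.Theorems

end
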